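import Summits.BirchSwinnertonDyer.BirchSwinnertonDyer.Theorems.ManinLocalTwoThreeBracketSturmFiftyTwo
import Summits.BirchSwinnertonDyer.BirchSwinnertonDyer.Theorems.ManinLocalTwoThreeNewformPinningFiftyTwo
import HarnessLib

/-!
# `|c| = 1` on `X₀(52)` — UNCONDITIONALLY: the genus-FIVE level `52 = 2²·13` of the crux C2's domain (`2² ∣ 52`)

Cell bsd-f2-manin, route `ManinLocalTwoThree` (crux C2 `ManinOddAtFour`, stmt-BirchSwinnertonDyer-22967), LEAD p1 gen 24; the capstone of
the level-`52` chain: LEAD's FACT-FREE FRICKE-SIEVE PINNING `LevelFiftyTwo.f_apply_eq_F52a` (`⇑D.f = ⇑F52a` for EVERY `X₀(52)`-datum;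
an g51's device T-an-g51-52 assembled in `…NewformPinningFiftyTwo`) discharges the hypothesis `hpin` of an g53's Bracket–Sturm certificate
`BracketSturm.FiftyTwo.abs_maninConstant_eq_one_fiftyTwo_of_pinning` (`…BracketSturmFiftyTwo`: the defect of the weight-2 ratio
certificate of `52a1` vanishes to `q⁸⁴`, kernel evaluation; p3's Néron squeeze).

* **`abs_maninConstant_eq_one_fiftyTwo (W) [IsElliptic] [IsGloballyMinimal] (D : ModularParametrizationData W 52) (hopt) :
  |D.maninConstant| = 1`** — hence **`2 ∤ c`** (`not_two_dvd_maninConstant_fiftyTwo`, the body of C2 at `N = 52` with NONE of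
  the item's hypotheses: no Mazur, Abbes–Ullmo, Česnavičius, modularity, CDT) and `p ∤ c`.

HONEST FRAMING: unconditional (standard axioms).  The `∀ N` crux C2, Manin's conjecture and BSD are NOT proved; item 22967 stays
OPEN as filed.  No definition, no named fact, no sorry. [cite: AgasheRibetStein2006, §§1–2] [cite: CremonaAlgorithms1997, Table 1 (52a1)]
-/

set_option autoImplicit false
-- lint-debt: the directory name repeats the summit name (sibling precedent `ManinLocalTwoThreeManinConstantFortyFour.lean`)
set_option linter.dupNamespace false

noncomputable section

open Complex
open UpperHalfPlane hiding I
open scoped MatrixGroups ModularForm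
open ModularForm CongruenceSubgroup
open Literature.NumberTheory.EllipticCurves Literature.NumberTheory.EllipticCurves.ModularForms

namespace Summit.BirchSwinnertonDyer.BirchSwinnertonDyer.Theorems.ManinLocalTwoThree.ManinConstantFiftyTwo

open LevelFiftyTwo BracketSturm.FiftyTwo

/-- The pinning in an g53's pointwise shape: `D.f τ = −C1 τ − C2 τ + C7 τ + ¼·C8 τ − C9 τ − ¼·C10 τ`. [cite: AtkinLehner1970, Thm. 3] -/
theorem pinning_fiftyTwo {W : WeierstrassCurve ℚ} [W.IsElliptic] (D : ModularParametrizationData W 52) (τ : ℍ) :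
    D.f τ = -C1 τ - C2 τ + C7 τ + (1 / 4 : ℂ) * C8 τ - C9 τ - (1 / 4 : ℂ) * C10 τ := by
  have h := congrFun (f_apply_eq_F52a D) τ
  rw [h, F52a]
  simp only [ModularForm.add_apply, ModularForm.IsGLPos.smul_apply, smul_eq_mul]
  ring

/-- **`|c| = 1` on `X₀(52)`, UNCONDITIONALLY**: for every globally minimal elliptic `W/ℚ` and every `X₀(52)`-parametrisation datum `D`
of `W` with the lattice clause `Λ_W = c·Λ(D.f)`. [cite: AgasheRibetStein2006, §§1–2] -/
theorem abs_maninConstant_eq_one_fiftyTwo (W : WeierstrassCurve ℚ) [W.IsElliptic] [W.IsGloballyMinimal]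
    (D : ModularParametrizationData W 52)
    (hopt : ∀ z ∈ D.L.lattice, ∃ w ∈ periodLattice D.f, z = D.c * w) :
    |D.maninConstant| = 1 :=
  abs_maninConstant_eq_one_fiftyTwo_of_pinning W D hopt (pinning_fiftyTwo D)

/-- **`2 ∤ c` on `X₀(52)`, UNCONDITIONALLY** — the body of the crux C2 `ManinOddAtFour` at `N = 52` (`2² ∣ 52`) with none of its
fact hypotheses. [cite: AgasheRibetStein2006, §§1–2] -/
theorem not_two_dvd_maninConstant_fiftyTwo (W : WeierstrassCurve ℚ) [W.IsElliptic] [W.IsGloballyMinimal]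
    (D : ModularParametrizationData W 52)
    (hopt : ∀ z ∈ D.L.lattice, ∃ w ∈ periodLattice D.f, z = D.c * w) :
    ¬ (2 : ℤ) ∣ D.maninConstant := by
  have h := abs_maninConstant_eq_one_fiftyTwo W D hopt
  intro h2
  have := Int.le_of_dvd (by rw [h]; norm_num) ((dvd_abs _ _).mpr h2)
  rw [h] at this
  norm_num at this

/-- **No prime divides `c` on `X₀(52)`.** [cite: AgasheRibetStein2006, §§1–2] -/
theorem not_prime_dvd_maninConstant_fiftyTwo (W : WeierstrassCurve ℚ) [W.IsElliptic] [W.IsGloballyMinimal]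
    (D : ModularParametrizationData W 52)
    (hopt : ∀ z ∈ D.L.lattice, ∃ w ∈ periodLattice D.f, z = D.c * w) {p : ℕ} (hp : p.Prime) :
    ¬ (p : ℤ) ∣ D.maninConstant := by
  have h := abs_maninConstant_eq_one_fiftyTwo W D hopt
  intro hd
  have h1 := Int.le_of_dvd (by rw [h]; norm_num) ((dvd_abs _ _).mpr hd)
  rw [h] at h1
  have h2 := hp.two_le
  omega

/-- **C2's inner clause at `N = 52` in the item's literal shape**: `2² ∣ 52 → 2 ∤ c(D)` for every datum with the lattice clause.
[cite: AgasheRibetStein2006, §§1–2] -/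
theorem maninOddAtFour_inner_fiftyTwo :
    ∀ (W : WeierstrassCurve ℚ) [W.IsElliptic] [W.IsGloballyMinimal] (D : ModularParametrizationData W 52),
      (∀ z ∈ D.L.lattice, ∃ w ∈ periodLattice D.f, z = D.c * w) → 2 ^ 2 ∣ 52 → ¬ (2 : ℤ) ∣ D.maninConstant :=
  fun W _ _ D hopt _ ↦ not_two_dvd_maninConstant_fiftyTwo W D hopt

end Summit.BirchSwinnertonDyer.BirchSwinnertonDyer.Theorems.ManinLocalTwoThree.ManinConstantFiftyTwo

end
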